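import Literature.AlgebraicGeometry.HodgeTheory.HodgeClassesProductSpanCriterion
import HarnessLib

/-!
# A criterion for `HodgeClassesProductSpan`, typed form: rational Hodge classes in the span of (classes of type `(l,l)` of `B`) ⊠ (classes of pure type of `Z`) are spanned by exterior products of RATIONAL Hodge classes (Künneth uniqueness + rationality of Künneth coefficients + the type projectors; Hatcher Thm. 3.16, Voisin I §7.1.1 / §11.3)

Family `hodge`, layer `Literature/AlgebraicGeometry/HodgeTheory`. Research context: cell `pub-hodge-ring2`
(HONEST FRAMING: research route conditional on HC_CM; not a corollary; Q11.4-sentence-2 already refuted in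
dim ≥ 3), Literature lane, programme R5 («no type IV × CM»: Lombardo 2016 Lemma 3.4 / Moonen–Zarhin 1999
(3.1) for every `A` without factor of type IV). UNCONDITIONAL; theorems only, no definition, no named fact;
no step towards a summit statement.

THE CRITERION `mem_span_hodgeProductClasses_of_mem_span_pureType`. Let `B`, `Z` be complex abelian varieties
and `c ∈ H^{2p}((B × Z)(ℂ); ℂ)` a RATIONAL class of Hodge type `(p,p)` lying in the `ℂ`-span of the classes
`pr_B^* d ⌣ pr_Z^* μ` with `d` a COMPLEX class of `B` of Hodge type `(l,l)` (`2l = deg d`; no rationality asked)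
and `μ` of some pure type `(r₀, r₁)` on `Z`. Then `c` lies in the span of `hodgeProductClasses B Z p` (exterior
products of RATIONAL Hodge classes of `B` and of `Z`). Compared with the tree's criterion
`mem_span_hodgeProductClasses_of_mem_span_typed` (`HodgeClassesProductSpanCriterion`, programme R4), the
hypothesis «`d` in the `ℂ`-span of the RATIONAL `(l,l)`-classes» is weakened to «`d` of type `(l,l)`»: this is
the shape produced by a Lie step that only knows that the Hodge operator `Θ_B ⊗ 1` of the first factor kills
`c` (the splitting `Hg(B × Z) = Hg(B) × Hg(Z)`, Moonen–Zarhin 1999 (3.1), read on tensors: the invariants of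
`Hg(B) × 1` in `H(B) ⊗ H(Z)` are `H(B)^{Hg(B)} ⊗ H(Z)`), and the rationality of the `B`-side classes is
RECOVERED here from the rationality of `c`.

PROOF. (1) The type projector `π_{(p,p)}` of `B × Z` kills `pr_B^* d ⌣ pr_Z^* μ` unless `μ` is balanced, since
types add under exterior products (Voisin I Thm. 11.38, the tree's `CupPreservesHodgeType`), so `c = π c` lies
in the span of the products with `d` of type `(l,l)` and `μ` of type `(k,k)`. (2) Expand along the Künneth
decomposition with RATIONAL bases `ζ` of `H^•(Z)` (Hatcher Thm. 3.16, the tree's `complexBetti_kunneth_bijective`):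
`c = Σ_J pr_B^* a_J ⌣ pr_Z^* ζ_J` with UNIQUE `a_J`, which are RATIONAL (`isRationalClass_kunneth_symm_apply`)
and of type `(l,l)` (the Künneth coefficients of a generator `pr_B^* d ⌣ pr_Z^* μ` are multiples of `d`,
`kunneth_symm_cupProduct_eq_sum`, and the classes of type `(l,l)` form the type piece of a Hodge model, a
linear subspace). (3) Split each `ζ_J` into its type components `π_{(r₀,r₁)} ζ_J` (`sum_typeProj`): now `c`
is in the span of the `pr_B^* a_J ⌣ pr_Z^* π_{(r₀,r₁)} ζ_J` with `a_J` a RATIONAL `(l,l)`-class, and the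
tree's criterion `mem_span_hodgeProductClasses_of_mem_span_typed` concludes.

## References

* [HatcherAT2002] A. Hatcher, *Algebraic Topology* (2002), §3.2 Thm. 3.16. [cite: HatcherAT2002, §3.2 Thm. 3.16]
* [VoisinHodgeI2002] C. Voisin, *Hodge Theory I*, §7.1.1, Thm. 6.18, §11.3.2 Thm. 11.38. [cite: VoisinHodgeI2002, §11.3.2 Thm. 11.38]
* [MoonenZarhin1999LowDim] B. Moonen, Yu. Zarhin, Math. Ann. 315 (1999), §3 (3.1). [cite: MoonenZarhin1999LowDim, §3 (3.1)]
-/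

noncomputable section

open CategoryTheory MonoidalCategory CartesianMonoidalCategory
open Literature.AlgebraicTopology.SingularHomology
open Literature.AlgebraicGeometry.Motives

namespace Literature.AlgebraicGeometry.HodgeTheory

section Criterion

set_option maxHeartbeats 800000 in
/-- **THE TYPED CRITERION.** For complex abelian varieties `B`, `Z` and a RATIONAL class `c` of Hodge type
`(p,p)` on `B × Z` lying in the `ℂ`-span of the classes `pr_B^* d ⌣ pr_Z^* μ` with `d` a (complex) class of
`B` of type `(l,l)` (`2l = deg d`) and `μ` of some pure type `(r₀,r₁)` on `Z`: `c` is a `ℂ`-combination of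
exterior products of RATIONAL Hodge classes of `B` and of `Z` (`hodgeProductClasses B Z p`). The rationality
of the `B`-side classes is recovered from that of `c`: the Künneth coefficients of `c` along rational bases
of `H^•(Z)` are rational AND of type `(l,l)`; then the tree's `mem_span_hodgeProductClasses_of_mem_span_typed`.
This is the passage from «the invariants of `Hg(B) × 1` are `H(B)^{Hg(B)} ⊗ H(Z)`» to Moonen–Zarhin's
«`B(B × Z)` is generated by `B(B)` and `B(Z)`» when `Hg(B × Z) = Hg(B) × Hg(Z)`.
[cite: MoonenZarhin1999LowDim, §3 (3.1)] [cite: HatcherAT2002, §3.2 Thm. 3.16]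
[cite: VoisinHodgeI2002, Thm. 6.18 and §11.3.2 Thm. 11.38] -/
theorem mem_span_hodgeProductClasses_of_mem_span_pureType (B Z : AbelianVariety ℂ) {p : ℕ}
    {c : complexBetti (B.X ⊗ Z.X) (2 * p)} (hcQ : IsRationalClass c)
    (hc : IsOfHodgeType (B.dim + Z.dim) (B.X ⊗ Z.X) (2 * p) p p c)
    (hmem : c ∈ Submodule.span ℂ {z : complexBetti (B.X ⊗ Z.X) (2 * p) | ∃ (i j : ℕ) (hij : i + j = 2 * p)
      (d : complexBetti B.X i) (μ : complexBetti Z.X j),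
      (∃ l, 2 * l = i ∧ IsOfHodgeType B.dim B.X i l l d) ∧
      (∃ r₀ r₁, r₀ + r₁ = j ∧ IsOfHodgeType Z.dim Z.X j r₀ r₁ μ) ∧
      z = cupProduct hij (complexBetti.map (fst B.X Z.X) i d) (complexBetti.map (snd B.X Z.X) j μ)}) :
    c ∈ Submodule.span ℂ (hodgeProductClasses B Z p) := by
  classical
  -- the setting
  have hB : IsSmoothProjective B.dim B.X := AbelianVariety.isSmoothProjective_holds
  have hZ : IsSmoothProjective Z.dim Z.X := AbelianVariety.isSmoothProjective_holds
  have hX : IsSmoothProjective (B.dim + Z.dim) (B.X ⊗ Z.X) := IsSmoothProjective.tensor_holds hB hZ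
  have hI : hodgePQ_independent_of_hodgeModel := hodgePQ_independent_of_hodgeModel_holds
  obtain ⟨MB⟩ := nonempty_hodgeModel_holds (n := B.dim) (X := B.X) hB
  obtain ⟨MZ⟩ := nonempty_hodgeModel_holds (n := Z.dim) (X := Z.X) hZ
  obtain ⟨MX⟩ := nonempty_hodgeModel_holds (n := B.dim + Z.dim) (X := B.X ⊗ Z.X) hX
  have hcup : CupPreservesHodgeType (B.dim + Z.dim) (B.X ⊗ Z.X) :=
    cupPreservesHodgeType_of_multiplicative_deRham
      (fun E _ _ _ ↦ Literature.NumberTheory.Transcendental.exists_deRhamIsoFamily_holds E) hX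
  haveI := fun i ↦ finite_complexBetti hB i
  haveI := fun j ↦ finite_complexBetti hZ j
  -- STEP 1: the type projector `π_{(p,p)}` keeps only the balanced products
  let pp : ↥(Finset.HasAntidiagonal.antidiagonal (2 * p)) :=
    ⟨(p, p), Finset.HasAntidiagonal.mem_antidiagonal.2 (by omega)⟩
  set π := MX.typeProj (2 * p) pp with hπ
  set S₁ : Set (complexBetti (B.X ⊗ Z.X) (2 * p)) := {z | ∃ (i j : ℕ) (hij : i + j = 2 * p)
      (d : complexBetti B.X i) (μ : complexBetti Z.X j) (l k : ℕ), 2 * l = i ∧ 2 * k = j ∧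
      IsOfHodgeType B.dim B.X i l l d ∧ IsOfHodgeType Z.dim Z.X j k k μ ∧
      z = cupProduct hij (complexBetti.map (fst B.X Z.X) i d) (complexBetti.map (snd B.X Z.X) j μ)} with hS₁
  have hπc : π c = c :=
    MX.typeProj_apply_of_mem (MX.mem_typePiece_of_isOfHodgeType hI hX pp.2 hc)
  have hstep1 : c ∈ Submodule.span ℂ S₁ := by
    rw [← hπc]
    have hle : Submodule.span ℂ {z : complexBetti (B.X ⊗ Z.X) (2 * p) | ∃ (i j : ℕ) (hij : i + j = 2 * p)
        (d : complexBetti B.X i) (μ : complexBetti Z.X j),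
        (∃ l, 2 * l = i ∧ IsOfHodgeType B.dim B.X i l l d) ∧
        (∃ r₀ r₁, r₀ + r₁ = j ∧ IsOfHodgeType Z.dim Z.X j r₀ r₁ μ) ∧
        z = cupProduct hij (complexBetti.map (fst B.X Z.X) i d) (complexBetti.map (snd B.X Z.X) j μ)} ≤
        (Submodule.span ℂ S₁).comap π := by
      refine Submodule.span_le.2 ?_
      rintro z ⟨i, j, hij, d, μ, ⟨l, hl, hd⟩, ⟨r₀, r₁, hr, hμ⟩, rfl⟩
      change π (cupProduct hij (complexBetti.map (fst B.X Z.X) i d) (complexBetti.map (snd B.X Z.X) j μ)) ∈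
        Submodule.span ℂ S₁
      have htyp : IsOfHodgeType (B.dim + Z.dim) (B.X ⊗ Z.X) (2 * p) (l + r₀) (l + r₁)
          (cupProduct hij (complexBetti.map (fst B.X Z.X) i d) (complexBetti.map (snd B.X Z.X) j μ)) :=
        hcup hij (hd.map_of_isSmoothProjective hX hB (fst B.X Z.X))
          (hμ.map_of_isSmoothProjective hX hZ (snd B.X Z.X))
      have hanti : (l + r₀, l + r₁) ∈ Finset.HasAntidiagonal.antidiagonal (2 * p) :=
        Finset.HasAntidiagonal.mem_antidiagonal.2 (by omega)
      have hmemX := MX.mem_typePiece_of_isOfHodgeType hI hX hanti htyp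
      by_cases heq : (⟨(l + r₀, l + r₁), hanti⟩ : ↥(Finset.HasAntidiagonal.antidiagonal (2 * p))) = pp
      · have h0 : r₀ = r₁ := by
          have h1 := congrArg (fun x : ↥(Finset.HasAntidiagonal.antidiagonal (2 * p)) => x.1) heq
          simp only [pp, Prod.mk.injEq] at h1
          omega
        subst h0
        rw [heq] at hmemX
        rw [MX.typeProj_apply_of_mem hmemX]
        exact Submodule.subset_span ⟨i, j, hij, d, μ, l, r₀, hl, by omega, hd, hμ, rfl⟩
      · rw [MX.typeProj_apply_of_mem_ne heq hmemX]
        exact Submodule.zero_mem _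
    exact hle hmem
  -- STEP 2: Künneth coefficients along rational bases of `H^•(Z)`: rational AND of type `(l,l)`
  choose rZ ζ hζ using fun j : ℕ => exists_basis_isRationalClass hZ j
  let bZ : (j : Fin (2 * Z.dim + 1)) → Module.Basis (Fin (rZ j)) ℂ (complexBetti Z.X j) := fun j => ζ j
  set E := LinearEquiv.ofBijective _ (complexBetti_kunneth_bijective hB hZ bZ (2 * p)) with hE
  set a : LerayHirsch.Src ℂ (fun J : (Σ j : Fin (2 * Z.dim + 1), Fin (rZ j)) ↦ (J.1 : ℕ))
    (ComplexPoints B.X) (2 * p) := E.symm c with ha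
  have haQ : ∀ J, IsRationalClass (a J) := fun J =>
    isRationalClass_kunneth_symm_apply hB hZ bZ (fun j i => hζ j i) (2 * p) hcQ J
  -- the spans of the `(l,l)`-classes, degree by degree
  set T : (jf : Fin (2 * Z.dim + 1)) → Set (complexBetti B.X (2 * p - jf)) := fun jf =>
    {d' | ∃ l, 2 * l = 2 * p - (jf : ℕ) ∧ IsOfHodgeType B.dim B.X (2 * p - jf) l l d'} with hT
  have haT : ∀ J, a J ∈ Submodule.span ℂ (T J.1.1) := by
    intro J
    have hle : Submodule.span ℂ S₁ ≤
        (Submodule.span ℂ (T J.1.1)).comap (LinearMap.proj J ∘ₗ E.symm.toLinearMap) := by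
      refine Submodule.span_le.2 ?_
      rintro z ⟨i, j, hij, d, μ, l, k, hl, hk, hd, hμ, rfl⟩
      change (E.symm (cupProduct hij (complexBetti.map (fst B.X Z.X) i d)
        (complexBetti.map (snd B.X Z.X) j μ))) J ∈ Submodule.span ℂ (T J.1.1)
      obtain rfl : i = 2 * p - j := by omega
      by_cases hjn : j ≤ 2 * Z.dim
      · have hjp : j ≤ 2 * p := by omega
        let jf : Fin (2 * Z.dim + 1) := ⟨j, by omega⟩
        have hexp := kunneth_symm_cupProduct_eq_sum hB hZ bZ (2 * p) (j := jf) hjp d μ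
        rw [hE, hexp, Finset.sum_apply]
        refine Submodule.sum_mem _ fun i _ => ?_
        rw [Pi.smul_apply]
        by_cases hJ : J = ⟨⟨jf, i⟩, hjp⟩
        · rw [hJ, Pi.single_eq_same]
          exact Submodule.smul_mem _ _ (Submodule.subset_span ⟨l, hl, hd⟩)
        · rw [Pi.single_eq_of_ne hJ, smul_zero]
          exact Submodule.zero_mem _
      · haveI := subsingleton_complexBetti hZ (show 2 * Z.dim < j by omega)
        rw [Subsingleton.elim μ 0, map_zero, map_zero, map_zero, Pi.zero_apply]
        exact Submodule.zero_mem _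
    exact hle hstep1
  -- the `(l,l)`-classes of a fixed degree form a linear subspace (a type piece), so `a J` is one of them
  have haR : ∀ J, a J ∈ Submodule.span ℂ {d' : complexBetti B.X (2 * p - J.1.1) | IsRationalClass d' ∧
      ∃ l, 2 * l = 2 * p - (J.1.1 : ℕ) ∧ IsOfHodgeType B.dim B.X (2 * p - J.1.1) l l d'} := by
    intro J
    by_cases hev : ∃ l, 2 * l = 2 * p - (J.1.1 : ℕ)
    · obtain ⟨l, hl⟩ := hev
      have hanti : (l, l) ∈ Finset.HasAntidiagonal.antidiagonal (2 * p - (J.1.1 : ℕ)) :=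
        Finset.HasAntidiagonal.mem_antidiagonal.2 (by omega)
      have hTle : Submodule.span ℂ (T J.1.1) ≤ MB.typePiece (2 * p - J.1.1) ⟨(l, l), hanti⟩ := by
        refine Submodule.span_le.2 ?_
        rintro d' ⟨l', hl', hd'⟩
        obtain rfl : l' = l := by omega
        exact MB.mem_typePiece_of_isOfHodgeType hI hB hanti hd'
      have hmem' : a J ∈ MB.typePiece (2 * p - J.1.1) ⟨(l, l), hanti⟩ := hTle (haT J)
      -- elaborate bottom-up (the type pieces must not be unfolded by the unifier)
      have htyp' := MB.isOfHodgeType_of_mem_typePiece hmem'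
      exact Submodule.subset_span ⟨haQ J, l, hl, htyp'⟩
    · have hTbot : Submodule.span ℂ (T J.1.1) = ⊥ := by
        rw [Submodule.span_eq_bot]
        rintro d' ⟨l', hl', -⟩
        exact absurd ⟨l', hl'⟩ hev
      have h0 : a J = 0 := by
        have h := haT J
        rw [hTbot, Submodule.mem_bot] at h
        exact h
      rw [h0]
      exact Submodule.zero_mem _
  -- STEP 3: `c = Σ_J pr_B^* a_J ⌣ pr_Z^* ζ_J`, and `ζ_J = Σ_{(r₀,r₁)} π_{(r₀,r₁)} ζ_J`
  have hc_lh : c = ∑ J, cupProduct (Nat.sub_add_cancel J.2) (complexBetti.map (fst B.X Z.X) (2 * p - J.1.1) (a J))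
      (complexBetti.map (snd B.X Z.X) J.1.1 (bZ J.1.1 J.1.2)) := by
    conv_lhs => rw [show c = E a from (E.apply_symm_apply c).symm, hE, LinearEquiv.ofBijective_apply,
      LerayHirsch.lhMap_eq_sum_idx]
  have hmem' : c ∈ Submodule.span ℂ {z : complexBetti (B.X ⊗ Z.X) (2 * p) | ∃ (i j : ℕ) (hij : i + j = 2 * p)
      (d : complexBetti B.X i) (μ : complexBetti Z.X j),
      d ∈ Submodule.span ℂ {d' : complexBetti B.X i | IsRationalClass d' ∧
        ∃ l, 2 * l = i ∧ IsOfHodgeType B.dim B.X i l l d'} ∧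
      (∃ r₀ r₁, r₀ + r₁ = j ∧ IsOfHodgeType Z.dim Z.X j r₀ r₁ μ) ∧
      z = cupProduct hij (complexBetti.map (fst B.X Z.X) i d) (complexBetti.map (snd B.X Z.X) j μ)} := by
    rw [hc_lh]
    refine Submodule.sum_mem _ fun J _ => ?_
    have hζsum : (bZ J.1.1 J.1.2 : complexBetti Z.X J.1.1) =
        ∑ rs, MZ.typeProj (J.1.1 : ℕ) rs (bZ J.1.1 J.1.2) := (MZ.sum_typeProj _ _).symm
    rw [hζsum, map_sum, map_sum]
    refine Submodule.sum_mem _ fun rs _ => Submodule.subset_span ?_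
    refine ⟨2 * p - J.1.1, J.1.1, Nat.sub_add_cancel J.2, a J, MZ.typeProj (J.1.1 : ℕ) rs (bZ J.1.1 J.1.2),
      haR J, ⟨rs.1.1, rs.1.2, Finset.HasAntidiagonal.mem_antidiagonal.1 rs.2, ?_⟩, rfl⟩
    -- elaborate bottom-up
    have htypZ := MZ.isOfHodgeType_of_mem_typePiece (MZ.typeProj_mem (J.1.1 : ℕ) rs (bZ J.1.1 J.1.2))
    exact htypZ
  exact mem_span_hodgeProductClasses_of_mem_span_typed B Z hcQ hc hmem'

end Criterion

end Literature.AlgebraicGeometry.HodgeTheory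

end
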